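import Summits.Ventures.PercRepro.C041TreeEmb
import Summits.Ventures.PercRepro.C041PendantMarked

/-!
# ROW C-041 — SUMMARY of p6 gen 30: stray-vertex invariance, the one-marked-vertex seed in cone form, the class
`IsZe`, marks at the anchor, THEOREM (trees) in cone form — every end theorem restated with all its hypotheses in
the type (p6, gen 30)

Nothing new is proved here: each statement is the landed theorem applied (`C041ZoneEmb`, `C041OneVertexCone`,
`C041ConeClassE`, `C041PendantMarked`, `C041GlueFold`, `C041FoldMaps`, `C041TreeEmb`), so that a reader sees the
exact claims at one place.
-/

namespace PercRepro

namespace ZoneZ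

open ZoneData TreeClosure Pendant AnchorGlue PointZone OneVertex MarkedPendant AZone Finset

/-- **STRAY-VERTEX INVARIANCE.** A zone embedding `φ : ZoneEmb Z Z'` (injective vertex map, bijections of edges,
`1`-edges and `2`-edges commuting with the end maps) does not change the six-vector at an image anchor. -/
theorem row_C041_stray_sixVec {V E T₁ T₂ V' E' T₁' T₂' : Type*} {Z : ZoneData V E T₁ T₂}
    {Z' : ZoneData V' E' T₁' T₂'} (φ : ZoneEmb Z Z') [Fintype E] [DecidableEq E] [Fintype T₁] [DecidableEq T₁]
    [Fintype T₂] [DecidableEq T₂] [Fintype E'] [DecidableEq E'] [Fintype T₁'] [DecidableEq T₁'] [Fintype T₂']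
    [DecidableEq T₂'] (k : V) : Z'.sixVec (φ.v k) = Z.sixVec k :=
  φ.sixVec_eq k

/-- **THE ONE-MARKED-VERTEX SEED IN CONE FORM.** Every zone (any multigraph) whose `1`- and `2`-marks all sit at one
vertex `v₀` has its six-vector in the cone, at every anchor `k`. -/
theorem row_C041_oneVertex_cone {V E T₁ T₂ : Type} (Z : ZoneData V E T₁ T₂) [Fintype E] [DecidableEq E]
    [Fintype T₁] [DecidableEq T₁] [Fintype T₂] [DecidableEq T₂] (v₀ : V) (h1 : ∀ i, Z.at₁ i = v₀)
    (h2 : ∀ j, Z.at₂ j = v₀) (k : V) : InCone (Z.sixVec k) :=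
  inCone_sixVec_oneVertex Z v₀ h1 h2 k

/-- **THE CLASS `IsZe`** (one-vertex seed, pendant attachment, gluing at the anchor, embeddings both ways): the
ZONE O-CUBE holds on every member. -/
theorem row_C041_IsZe_oCube {V E T₁ T₂ : Type} (Z : ZoneData V E T₁ T₂) (k : V) (h : IsZe Z k) [Fintype E]
    [DecidableEq E] [Fintype T₁] [DecidableEq T₁] [Fintype T₂] [DecidableEq T₂] :
    Z.ZoneOCubeConj {k} (∅ : Set V) :=
  h.zoneOCubeConj

/-- **MARKS AT THE ANCHOR OF THE MULTIGRAPH.** When every mark of `Z₁` sits at its anchor `a`, the six-vector of the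
marked pendant is the pendant's times `v 1 ^ #U₁ * v 0 ^ #U₂`. -/
theorem row_C041_marked_pendant {V₁ E₁ U₁ U₂ V₂ E₂ T₁ T₂ : Type} (Z₁ : ZoneData V₁ E₁ U₁ U₂) (u a : V₁)
    (Z₂ : ZoneData V₂ E₂ T₁ T₂) (a₂ : V₂) [Fintype U₁] [Fintype U₂] [Fintype E₁] [DecidableEq E₁] [Fintype E₂]
    [DecidableEq E₂] [Fintype T₁] [DecidableEq T₁] [Fintype T₂] [DecidableEq T₂] [DecidableEq U₁] [DecidableEq U₂]
    (h1 : ∀ i, Z₁.at₁ i = a) (h2 : ∀ j, Z₁.at₂ j = a) :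
    (pendantM Z₁ u Z₂ a₂).sixVec (Sum.inl a) =
      (pendant Z₁ u Z₂ a₂).sixVec (Sum.inl a) * v 1 ^ Fintype.card U₁ * v 0 ^ Fintype.card U₂ :=
  sixVec_pendantM Z₁ u Z₂ a₂ a h1 h2

/-- **THEOREM (trees) IN CONE FORM.** The canonical zone of every rooted marked tree is a member of the class and its
six-vector at the root lies in the cone. -/
theorem row_C041_tree_cone (t : TZ) : IsZe t.toZone t.root ∧ InCone (t.toZone.sixVec t.root) :=
  ⟨isZe_toZone t, inCone_sixVec_toZone t⟩

/-- **THEOREM (trees), the ZONE O-CUBE re-derived from the cone** on the canonical zone of every rooted marked tree. -/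
theorem row_C041_tree_oCube (t : TZ) : t.toZone.ZoneOCubeConj {t.root} (∅ : Set t.Pos) :=
  zoneOCubeConj_toZone' t

end ZoneZ

end PercRepro
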